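import Literature.Barriers.AtomisticToContinuum.HardDiskGibbsMeasurability
import HarnessLib

/-!
# Richthammer's estimate (3.5) for hard discs: the final steps of the printed proof
# (Richthammer 2007, §5.5), and the finite-volume form of (5.8) as a named fact

Second file of the bottom-up programme for `Richthammer2007_ineq35`
(`HardDiskTranslationInvarianceSteps.lean`; size XL: the estimate (3.5) is the whole content of
§5–§6 of the paper). The printed proof of (3.5) (§5.5 "Final steps of the proof", p. 12) runs:

1. for the fixed Gibbs measure `μ`, cylinder event `D ∈ 𝓕_{𝒳,Λ_{n'-1}}`, `τ ∈ [0, 1/2]`,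
   `e = e₁` (or `e₂`) and an arbitrary `δ > 0`, choose `R` (Lemma 7) and then `n ≥ R + 1` large
   (Lemma 13), the hard-core preserving generalised translations `𝔗_n`, `𝔗̄_n` (§5.4) and the
   good configurations `G_n ∈ 𝓕_𝒳` (5.3') with `μ(G_nᶜ) ≤ δ`;
2. by the DLR equation (3.1) in `Λ_n` and the density Lemma 11, for EVERY boundary condition
   `X̄` the finite-volume Gibbs weight of `𝔗_n(D ∩ G_n)` equals
   `∫ ν_{Λ_n}(dX|X̄) 1_{D ∩ G_n}(X) z^{#X_{Λ_n}} e^{-H_{Λ_n}(X)} φ_n(X)` (bijectivity Lemma 10,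
   `#(𝔗_n X)_{Λ_n} = #X_{Λ_n}` by (5.7), `H_{Λ_n}(𝔗_n X) = H_{Λ_n}(X)` by (5.4)–(5.5)), and the
   same with `𝔗̄_n`, `φ̄_n`; since `φ̄_n + φ_n ≥ 2 (φ̄_n φ_n)^{1/2} ≥ 2e^{-1/2} ≥ 1` on `G_n`
   (Lemma 12), integrating `μ(dX̄)` gives (5.8):
   `μ(𝔗̄_n(D ∩ G_n)) + μ(𝔗_n(D ∩ G_n)) ≥ μ(D ∩ G_n)`;
3. `𝔗_n(D ∩ G_n) ⊆ D + τe`, `𝔗̄_n(D ∩ G_n) ⊆ D - τe` (Lemma 9 and `D ∈ 𝓕_{𝒳,Λ_{n'-1}}`), so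
   `μ(D - τe) + μ(D + τe) ≥ μ(D) - δ`, and `δ → 0`.

This file vendors the OUTPUT of step 2 combined with the inclusions of step 3 — the inequality
between the finite-volume weights in `Λ_n`, for every boundary condition — together with
`μ(G_nᶜ) ≤ δ` (Lemma 13) as ONE named fact `Richthammer2007_ineq58` (everything in it that
refers to the construction `𝔗_n` is existentially packaged: only `n` and `G_n` survive), and
PROVES step 3, i.e. `Richthammer2007_ineq35` from it (`Richthammer2007_ineq35_of_ineq58`): the
DLR equation `μ(A) = ∫ γ_{Λ_n}(A|X̄) μ(dX̄)` for `A = D ∩ G_n`, `D ∓ τe`, measurability of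
`X̄ ↦ γ_{Λ_n}(A|X̄)` (`HardDiskGibbsMeasurability.lean`) to split the sum, `μ(D) ≤ μ(D ∩ G_n) + δ`,
and `δ → 0`.

What remains for `Richthammer2007_ineq35_holds` is `Richthammer2007_ineq58_holds`, i.e. the
construction of §5.2–5.4 and Lemmas 7–13 (§6); the plan is in the provefact notes.

## References

* [Richthammer2007] T. Richthammer, *Translation-invariance of two-dimensional Gibbsian point
  processes*, Comm. Math. Phys. 274 (2007) 81–122, arXiv:0706.3637: §3.3 (3.1) (p. 7), §5.1
  (p. 10), §5.3 (5.3') (p. 10), §5.4 Lemmas 9–11 (p. 11), §5.5 (5.8), Lemmas 12–13 (p. 12).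
-/

noncomputable section

open MeasureTheory Set
open scoped ENNReal

namespace Literature.Barriers.AtomisticToContinuum.HardDisk

open Literature.Analysis.FunctionSpaces

/-! ### (5.8) at the level of the finite-volume weights, as a named fact -/

/-- **Richthammer 2007, (5.8) with Lemma 13, in finite volume (hard-disc model).** For every
activity `z > 0`, Gibbs measure `μ` of the planar hard-disc model, direction `e = e_i`,
`τ ∈ [0, 1/2]`, cylinder event `D ∈ 𝓕_{𝒳,Λ_m}` and `δ > 0` there are `n > m` and a measurable
set `G` of configurations ("good configurations", `G_n ∈ 𝓕_𝒳` of (5.3')) with `μ(Gᶜ) ≤ δ`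
(Lemma 13) such that for EVERY boundary condition `X̄` the finite-volume hard-disc weights in
`Λ_n = [-n, n[²` satisfy
`W_{Λ_n}(D ∩ G | X̄) ≤ W_{Λ_n}(D - τe | X̄) + W_{Λ_n}(D + τe | X̄)`,
where `W_Λ(A | X̄) = ∑_k (z^k/k!) ∫_{Λ^k} 1_A 1_{hard core in Λ}(X_Λ X̄_{Λᶜ}) dx` (`weight`), i.e.
`Z_Λ(X̄) γ_Λ(A | X̄)` up to the factor `e^{-λ²(Λ)}`; here `D - τe = g_{τe}⁻¹ D` and
`D + τe = g_{-τe}⁻¹ D`. This is the displayed computation of §5.5 — by Lemma 11 (density `φ_n`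
of `ν_{Λ_n}(·|X̄)` under `𝔗_n`), Lemma 10 (bijectivity), (5.7) and (5.4)–(5.5) (conservation of
`#X_{Λ_n}` and of `H_{Λ_n}`), for every `X̄`,
`∫ν_{Λ_n}(dX|X̄) 1_{𝔗_n(D∩G_n)} z^{#X_{Λ_n}} e^{-H_{Λ_n}} = ∫ν_{Λ_n}(dX|X̄) 1_{D∩G_n} z^{#X_{Λ_n}} e^{-H_{Λ_n}} φ_n`,
likewise for `𝔗̄_n`, `φ̄_n`, and `φ̄_n + φ_n ≥ 1` on `G_n` (AM–GM and Lemma 12) — combined with the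
inclusions `𝔗_n(D ∩ G_n) ⊆ D + τe`, `𝔗̄_n(D ∩ G_n) ⊆ D - τe` (from Lemma 9) and Lemma 13; the
generalised translations `𝔗_n`, `𝔗̄_n` and densities are packaged existentially (only `n` and
`G = G_n` are exposed). Integrated against `μ(dX̄)` it is (5.8) proper.
[cite: Richthammer2007, §5.5 (5.8) and Lemmas 9–13 (pp. 11–12)] -/
def Richthammer2007_ineq58 : Prop :=
  ∀ z : ℝ, 0 < z → ∀ μ : Measure (PointConfig (EuclideanSpace ℝ (Fin 2))), IsGibbs z μ →
    ∀ i : Fin 2, ∀ t : ℝ, 0 ≤ t → t ≤ 1 / 2 → ∀ m : ℕ, ∀ D : Set (PointConfig (EuclideanSpace ℝ (Fin 2))),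
      IsCylinderEvent (box m) D → ∀ δ : ℝ, 0 < δ →
        ∃ n : ℕ, m < n ∧ ∃ G : Set (PointConfig (EuclideanSpace ℝ (Fin 2))), MeasurableSet G ∧
          μ Gᶜ ≤ ENNReal.ofReal δ ∧
            ∀ Y : PointConfig (EuclideanSpace ℝ (Fin 2)),
              weight z (box n) Y (D ∩ G) ≤
                weight z (box n) Y (PointConfig.translate (t • EuclideanSpace.single i (1 : ℝ)) ⁻¹' D) +
                  weight z (box n) Y (PointConfig.translate (-(t • EuclideanSpace.single i (1 : ℝ))) ⁻¹' D)

/-! ### From the finite-volume inequality to the conditional Gibbs distributions -/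

/-- The finite-volume inequality passes to the conditional Gibbs distributions
`γ_Λ(· | X̄) = W_Λ(· | X̄) / W_Λ(𝒳 | X̄)`. [cite: Richthammer2007, §5.5 (p. 12)] -/
theorem gibbsKernel_le_add_of_weight_le_add {z : ℝ} {Λ : Set (EuclideanSpace ℝ (Fin 2))} {Y : PointConfig (EuclideanSpace ℝ (Fin 2))}
    {A B C : Set (PointConfig (EuclideanSpace ℝ (Fin 2)))} (h : weight z Λ Y A ≤ weight z Λ Y B + weight z Λ Y C) :
    gibbsKernel z Λ Y A ≤ gibbsKernel z Λ Y B + gibbsKernel z Λ Y C := by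
  unfold gibbsKernel
  rw [← ENNReal.add_div]
  exact ENNReal.div_le_div_right h _

/-- **The DLR equation splits a sum**: for a Gibbs measure and measurable events `A`, `B`, `C`
in a bounded measurable `Λ`, a boundary-condition-wise inequality
`W_Λ(A|X̄) ≤ W_Λ(B|X̄) + W_Λ(C|X̄)` integrates to `μ(A) ≤ μ(B) + μ(C)` (uses (3.1) three times and
the measurability of `X̄ ↦ γ_Λ(·|X̄)`). [cite: Richthammer2007, §3.3 (3.1) and §5.5] -/
theorem IsGibbs.measure_le_add_of_weight_le_add {z : ℝ} {μ : Measure (PointConfig (EuclideanSpace ℝ (Fin 2)))}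
    (hμ : IsGibbs z μ) {Λ : Set (EuclideanSpace ℝ (Fin 2))} (hΛ : MeasurableSet Λ) (hΛb : Bornology.IsBounded Λ)
    {A B C : Set (PointConfig (EuclideanSpace ℝ (Fin 2)))} (hA : MeasurableSet A) (hB : MeasurableSet B)
    (hC : MeasurableSet C)
    (h : ∀ Y : PointConfig (EuclideanSpace ℝ (Fin 2)), weight z Λ Y A ≤ weight z Λ Y B + weight z Λ Y C) :
    μ A ≤ μ B + μ C := by
  rw [hμ.2 Λ hΛ hΛb A hA, hμ.2 Λ hΛ hΛb B hB, hμ.2 Λ hΛ hΛb C hC,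
    ← lintegral_add_left (measurable_gibbsKernel z hΛ hB)]
  exact lintegral_mono fun Y => gibbsKernel_le_add_of_weight_le_add (h Y)

/-! ### The final steps: (3.5) from (5.8) -/

/-- **Richthammer 2007, §5.5, last paragraph (proved): (3.5) follows from the finite-volume
(5.8) with Lemma 13.** Given `Richthammer2007_ineq58`, for every Gibbs measure `μ` of the
hard-disc model, `e = e_i`, `τ ∈ [0, 1/2]` and cylinder event `D ∈ 𝓕_{𝒳,Λ_m}`:
`μ(D) ≤ μ(D - τe) + μ(D + τe)`. Proof as printed: `μ(D) ≤ μ(D ∩ G_n) + μ(G_nᶜ) ≤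
μ(D - τe) + μ(D + τe) + δ` by the DLR equation in `Λ_n` and the boundary-condition-wise
inequality, "and `δ > 0` was chosen to be an arbitrary positive real, so we get the estimate (3.5)
by taking the limit `δ → 0`". [cite: Richthammer2007, §5.5 (p. 12)] -/
theorem Richthammer2007_ineq35_of_ineq58 (h58 : Richthammer2007_ineq58) :
    Richthammer2007_ineq35 := by
  intro z hz μ hμ i t ht0 ht1 m D hD
  have hDm : MeasurableSet D := hD.measurableSet (measurableSet_box _)
  have hD₁ : MeasurableSet
      (PointConfig.translate (t • EuclideanSpace.single i (1 : ℝ)) ⁻¹' D) :=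
    (PointConfig.measurable_translate _) hDm
  have hD₂ : MeasurableSet
      (PointConfig.translate (-(t • EuclideanSpace.single i (1 : ℝ))) ⁻¹' D) :=
    (PointConfig.measurable_translate _) hDm
  refine ENNReal.le_of_forall_pos_le_add fun δ hδ _ => ?_
  obtain ⟨n, -, G, hG, hμG, hW⟩ := h58 z hz μ hμ i t ht0 ht1 m D hD δ (by exact_mod_cast hδ)
  have hsplit : μ (D ∩ G) ≤
      μ (PointConfig.translate (t • EuclideanSpace.single i (1 : ℝ)) ⁻¹' D) +
        μ (PointConfig.translate (-(t • EuclideanSpace.single i (1 : ℝ))) ⁻¹' D) :=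
    hμ.measure_le_add_of_weight_le_add (measurableSet_box n) (isBounded_box n) (hDm.inter hG)
      hD₁ hD₂ hW
  calc μ D = μ (D ∩ G ∪ D \ G) := by rw [Set.inter_union_sdiff]
    _ ≤ μ (D ∩ G) + μ (D \ G) := measure_union_le _ _
    _ ≤ μ (D ∩ G) + μ Gᶜ := add_le_add le_rfl (measure_mono (Set.sdiff_subset_compl _ _))
    _ ≤ _ + ENNReal.ofReal δ := add_le_add hsplit hμG
    _ = _ + (δ : ℝ≥0∞) := by rw [ENNReal.ofReal_coe_nnreal]

end Literature.Barriers.AtomisticToContinuum.HardDisk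

end
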